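import Summits.QuantumFields.YangMills.Theorems.TwistedTraceScaling.Negative.CoreWindowLedger
import HarnessLib

/-!
# R54B (crux `TwistedTraceScaling`, stmt-QuantumFields-20203), part 2 of 2 of the (C4) window ledger (`…Negative.CoreWindowLedger`): the open band is admissible,
# the forced `hcore` input radius is admissible, the landed record's input window cannot host `BOBricks.𝒰`, and `hb_small` passes from the exponents to the defect constant

Standing disprover `ym-cdisprove-20203-1` (gen 43).  See part 1 for the setting; schedule B is `T_B = 9L·5β^{-1/2}ℓ² + β^{-1}`, `r_f = min(1/40, β^{-1/2}ℓ)`, `Γ_B = β^{-1}N_S`.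
* `windows_exponent_le` (deterministic): windows `δ ≤ Dβ^{-m}`, `δu ≤ Aβ^{-m}`, `σ ≤ Sβ^{-2m}`, `m ≤ 1/2`, `Cℓ²β^{-m} ≤ 1` ⇒ `η ≤ C·K·ℓ⁶·β^{-m}`
  (`C = D+A+S+45L+2`, `K = 1614|E|(45L+1)² + 216N_S + 145005300N₃ + 2193291N_P(45L+1)²`).
* ★★★ `windows_hb_small`: `s, p > 1/6`, `q > 1/3` ⇒ `∀ a > 0, ∀ᶠ β, η(β)² ≤ a·λ_b(L³β)` — the converse of R50/R52 (`p`), R53/R53S (`q`) and part 1 §5 (`s`, `p` endpoints).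
* ★★ `hcore_windows_hb_small`: the input radius `13(L³β)^{-1/5}` forced by `BOBricks.hcore` (part 1 §2) is admissible (`1/5 > 1/6`).
* ★★ `record_inputWindow_not_core`: the record's input window `powScale (1/3) β` (p703178) eventually misses a configuration of the core `{orbitDist < 13(L³β)^{-1/5}}`.
* ★★ `announcedWindows_exponent_not_hb_small` / ★ `repairedWindows_exponent_hb_small` (§1c): lane A's announced (C4) windows `δ = δu = σ = β^{-1/3}` (`…BOCentralRatesSix`,
  exponent `→ 0`) FAIL `hb_small` (R53S, `q = 1/3`) and their input window is not a core window; with `δu = 13(L³β)^{-1/5}`, `σ ≤ Sβ^{-q}` (`q > 1/3`) the exponent passes.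
* `defectConst_le_three`, ★ `defectConst_hb_small`: `ε = max (1 − e^{−η}(1−η_c)) (e^{η}(1+η_c) − 1) ≤ 3(η+η_c)` on `[0,1]²`; `hb_small` for `η`, `η_c` ⇒ `hb_small` for `ε`.
HONEST FRAMING: stub of a child of the CONDITIONAL reduction route R2b1; nothing here refutes `TwistedTraceScaling`; (C4), (C5), (B-ST), C4-CORE remain OPEN; not infinite
volume, not a mass gap, not Clay.
-/

set_option autoImplicit false

noncomputable section

open Real Filter Topology
open Literature.MathematicalPhysics.QuantumFieldTheory
open Literature.MathematicalPhysics.QuantumLattice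
open Summit.QuantumFields.YangMills.Theorems.FemtoTransferGap
open Summit.QuantumFields.YangMills.Theorems.FemtoTransferGap.TwoLattice
open Summit.QuantumFields.YangMills.Theorems.FemtoTransferGap.TwoLattice.Toron (abelianCfg orbitDist_abelianCfg_le)
open Summit.QuantumFields.YangMills.Theorems.FemtoTransferGap.TwoLattice.Cov (stepActionErr stepActionErr_nonneg)
open Summit.QuantumFields.YangMills.Theorems.FemtoTransferGap.TwoLattice.ConstTube (norm_su2Quat_sub_sq coreEta coreEps1 coreEps2 btLog one_le_btLog
  schedT_le eventually_btLog_eq tendsto_btLog_atTop mul_powScale_one mul_powScale_half_sq tendsto_powScale_mul_btLog_pow powScale_mul_powScale tendsto_powScale'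
  coreEps1_nonneg coreEps2_nonneg coreEta_nonneg)
open Summit.QuantumFields.YangMills.Theorems.TwistedTraceScaling.Negative
open Summit.QuantumFields.YangMills.Theorems.TwistedTraceScaling.Negative.R54

namespace Summit.QuantumFields.YangMills.Theorems.TwistedTraceScaling.Negative.R54B

variable {L : ℕ} [NeZero L]

/-! ## §1 ★★★ The open band `s, p > 1/6`, `q > 1/3` is admissible -/

/-- ★★ **DETERMINISTIC BAND BOUND** on schedule B (`T_B`, `r_f = min(1/40, β^{-1/2}ℓ)`, `Γ_B = β^{-1}N_S`) at a fixed `β ≥ 1`: if `u := ℓ²·powScale m β` satisfies `C·u ≤ 1` with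
`C = D + A + S + 45L + 2`, `m ≤ 1/2`, and the windows obey `0 ≤ δ ≤ D·powScale m β`, `0 ≤ δu ≤ A·powScale m β`, `σ ≤ S·(powScale m β)²`, then
`η ≤ C·K·ℓ⁶·powScale m β` with `K = 1614|E|(45L+1)² + 216N_S + 145005300N₃ + 2193291N_P(45L+1)²`. [folklore] -/
theorem windows_exponent_le {m D A S : ℝ} (hmh : m ≤ 1 / 2) (hD : 0 ≤ D) (hA : 0 ≤ A) (hS : 0 ≤ S) {β δ δu σ : ℝ} (hβ1 : 1 ≤ β)
    (hCu : (D + A + S + 45 * (L : ℝ) + 2) * (btLog β ^ 2 * powScale m β) ≤ 1)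
    (hδ0 : 0 ≤ δ) (hδD : δ ≤ D * powScale m β) (hδu0 : 0 ≤ δu) (hδuA : δu ≤ A * powScale m β) (hσS : σ ≤ S * powScale m β ^ 2) :
    coreEta L β δ (δ + δu) (9 * (L : ℝ) * (5 * (powScale (1 / 2) β * btLog β ^ 2)) + powScale 1 β) (min (1 / 40) (powScale (1 / 2) β * btLog β))
          (powScale 1 β * Fintype.card (Site 3 L)) σ +
        coreEps1 L β δ (9 * (L : ℝ) * (5 * (powScale (1 / 2) β * btLog β ^ 2)) + powScale 1 β) (min (1 / 40) (powScale (1 / 2) β * btLog β)) +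
        coreEps2 L β δ (9 * (L : ℝ) * (5 * (powScale (1 / 2) β * btLog β ^ 2)) + powScale 1 β) (min (1 / 40) (powScale (1 / 2) β * btLog β)) σ ≤
      (D + A + S + 45 * (L : ℝ) + 2) *
          (1614 * (Fintype.card (Edge 3 L) : ℝ) * (45 * (L : ℝ) + 1) ^ 2 + 216 * (Fintype.card (Site 3 L) : ℝ) +
            145005300 * (Fintype.card (Plaquette 3 L × Fin 3) : ℝ) + 2193291 * (Fintype.card (Plaquette 3 L) : ℝ) * (45 * (L : ℝ) + 1) ^ 2) *
        btLog β ^ 6 * powScale m β := by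
  have hL1 : (1 : ℝ) ≤ (L : ℝ) := by exact_mod_cast Nat.one_le_iff_ne_zero.mpr (NeZero.ne L)
  have hβ : (0 : ℝ) ≤ β := by linarith
  set C : ℝ := D + A + S + 45 * (L : ℝ) + 2 with hC
  set K : ℝ := 1614 * (Fintype.card (Edge 3 L) : ℝ) * (45 * (L : ℝ) + 1) ^ 2 + 216 * (Fintype.card (Site 3 L) : ℝ) +
      145005300 * (Fintype.card (Plaquette 3 L × Fin 3) : ℝ) + 2193291 * (Fintype.card (Plaquette 3 L) : ℝ) * (45 * (L : ℝ) + 1) ^ 2 with hK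
  set ℓ := btLog β with hℓ
  set T := 9 * (L : ℝ) * (5 * (powScale (1 / 2) β * ℓ ^ 2)) + powScale 1 β with hT
  set R := min (1 / 40) (powScale (1 / 2) β * ℓ) with hR
  set Γ := powScale 1 β * Fintype.card (Site 3 L) with hΓ
  set u : ℝ := ℓ ^ 2 * powScale m β with hu
  have hC1 : 1 ≤ C := by rw [hC]; linarith only [hD, hA, hS, hL1]
  have hℓ1 : 1 ≤ ℓ := one_le_btLog β
  have hℓ2 : 1 ≤ ℓ ^ 2 := one_le_pow₀ hℓ1
  have hℓ4 : 1 ≤ ℓ ^ 4 := one_le_pow₀ hℓ1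
  have hpm : 0 < powScale m β := powScale_pos _ _
  have hu0 : 0 ≤ u := by positivity
  have hpu : powScale m β ≤ u := le_mul_of_one_le_left hpm.le hℓ2
  -- the window data are dominated by `ρ := C·u ≤ 1`
  have hδ' : δ ≤ C * u := by
    have h1 : D * powScale m β ≤ D * u := mul_le_mul_of_nonneg_left hpu hD
    have h2 : D * u ≤ C * u := mul_le_mul_of_nonneg_right (by rw [hC]; linarith only [hA, hS, hL1]) hu0
    linarith only [hδD, h1, h2]
  have hα' : δ + δu ≤ C * u := by
    have h1 : D * powScale m β ≤ D * u := mul_le_mul_of_nonneg_left hpu hD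
    have h1' : A * powScale m β ≤ A * u := mul_le_mul_of_nonneg_left hpu hA
    have h2 : (D + A) * u ≤ C * u := mul_le_mul_of_nonneg_right (by rw [hC]; linarith only [hS, hL1]) hu0
    linarith only [hδD, hδuA, h1, h1', h2]
  have hT0 : 0 ≤ T := R52.schedT_nonneg (L := L) β
  have hT' : T ≤ C * u := by
    have h1 : T ≤ (45 * (L : ℝ) + 1) * (powScale (1 / 2) β * ℓ ^ 2) := schedT_le (L := L) hβ1
    have h2 : powScale (1 / 2) β * ℓ ^ 2 ≤ u := by
      rw [hu, mul_comm]; exact mul_le_mul_of_nonneg_left (powScale_le_powScale hmh β) (by positivity)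
    have h3 : (45 * (L : ℝ) + 1) * (powScale (1 / 2) β * ℓ ^ 2) ≤ (45 * (L : ℝ) + 1) * u := mul_le_mul_of_nonneg_left h2 (by positivity)
    have h4 : (45 * (L : ℝ) + 1) * u ≤ C * u := mul_le_mul_of_nonneg_right (by rw [hC]; linarith only [hD, hA, hS]) hu0
    linarith only [h1, h3, h4]
  have hσ' : σ ≤ (C * u) ^ 2 := by
    have h1 : powScale m β ^ 2 ≤ u ^ 2 := pow_le_pow_left₀ hpm.le hpu 2
    have hSC : S ≤ C ^ 2 := by
      have : S ≤ C := by rw [hC]; linarith only [hD, hA, hL1]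
      nlinarith only [this, hC1]
    calc σ ≤ S * powScale m β ^ 2 := hσS
      _ ≤ C ^ 2 * u ^ 2 := mul_le_mul hSC h1 (sq_nonneg _) (by positivity)
      _ = (C * u) ^ 2 := by ring
  have hΓ0 : 0 ≤ Γ := mul_nonneg (powScale_pos _ _).le (Nat.cast_nonneg _)
  have hmain := exponent_le_radius (L := L) (R := R) hβ hΓ0 hCu hδ0 hδ' (add_nonneg hδ0 hδu0) hα' hσ' hT0 hT'
  -- schedule sizes
  have hX : β * T ^ 2 ≤ (45 * (L : ℝ) + 1) ^ 2 * ℓ ^ 4 := R52.beta_schedT_sq_le (L := L) hβ1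
  have hG : β * Γ = Fintype.card (Site 3 L) := by rw [hΓ, ← mul_assoc, mul_powScale_one hβ1, one_mul]
  have hY : β * R ^ 2 ≤ ℓ ^ 2 := by
    have hR0 : 0 ≤ R := le_min (by norm_num) (mul_nonneg (powScale_pos _ _).le (le_trans zero_le_one hℓ1))
    have hR1 : R ≤ powScale (1 / 2) β * ℓ := min_le_right _ _
    calc β * R ^ 2 ≤ β * (powScale (1 / 2) β * ℓ) ^ 2 := mul_le_mul_of_nonneg_left (pow_le_pow_left₀ hR0 hR1 2) hβ
      _ = (β * powScale (1 / 2) β ^ 2) * ℓ ^ 2 := by ring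
      _ = ℓ ^ 2 := by rw [mul_powScale_half_sq hβ1, one_mul]
  have hE : (0 : ℝ) ≤ (Fintype.card (Edge 3 L) : ℝ) := Nat.cast_nonneg _
  have hN : (0 : ℝ) ≤ (Fintype.card (Plaquette 3 L × Fin 3) : ℝ) := Nat.cast_nonneg _
  have hP : (0 : ℝ) ≤ (Fintype.card (Plaquette 3 L) : ℝ) := Nat.cast_nonneg _
  have hNS : (0 : ℝ) ≤ (Fintype.card (Site 3 L) : ℝ) := Nat.cast_nonneg _
  have hbr : 1614 * (Fintype.card (Edge 3 L) : ℝ) * (β * T ^ 2) + 216 * (β * Γ) + 145005300 * (Fintype.card (Plaquette 3 L × Fin 3) : ℝ) * (β * R ^ 2) +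
      2193291 * (Fintype.card (Plaquette 3 L) : ℝ) * (β * T ^ 2) ≤ K * ℓ ^ 4 := by
    rw [hG, hK]
    have h1 := mul_le_mul_of_nonneg_left hX (mul_nonneg (by norm_num : (0:ℝ) ≤ 1614) hE)
    have h2 := mul_le_mul_of_nonneg_left hY (mul_nonneg (by norm_num : (0:ℝ) ≤ 145005300) hN)
    have h3 := mul_le_mul_of_nonneg_left hX (mul_nonneg (by norm_num : (0:ℝ) ≤ 2193291) hP)
    have hℓ24 : ℓ ^ 2 ≤ ℓ ^ 4 := by nlinarith only [hℓ2]
    have h4 := mul_le_mul_of_nonneg_left hℓ24 (mul_nonneg (by norm_num : (0:ℝ) ≤ 145005300) hN)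
    have h5 := mul_le_mul_of_nonneg_left hℓ4 (mul_nonneg (by norm_num : (0:ℝ) ≤ 216) hNS)
    linarith only [h1, h2, h3, h4, h5]
  have hρ0 : 0 ≤ C * u := by positivity
  calc _ ≤ C * u * (K * ℓ ^ 4) := hmain.trans (mul_le_mul_of_nonneg_left hbr hρ0)
    _ = C * K * ℓ ^ 6 * powScale m β := by rw [hu]; ring

/-- ★★★ **THE OPEN BAND IS ADMISSIBLE** (converse of R50/R52/R53/R53S and of the two slots above): on schedule B, if the three (C4) windows obey
`0 ≤ δ ≤ D·β^{-s}`, `0 ≤ δu ≤ A·β^{-p}`, `0 ≤ σ ≤ S·β^{-q}` eventually with `s, p > 1/6` and `q > 1/3`, then the full exponent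
`η = coreEta L β δ (δ+δu) T_B r_f Γ_B σ + coreEps1 L β δ T_B r_f + coreEps2 L β δ T_B r_f σ` is `O(ℓ⁶β^{-m})`, `m = min(s, p, q/2, 1/2) > 1/6`, and meets `hb_small` with
`b := η` itself: `∀ a > 0, ∀ᶠ β, η(β)² ≤ a·λ_b(L³β)`. [cite: Luscher1983, §3] -/
theorem windows_hb_small {s p q D A S : ℝ} (hs : 1 / 6 < s) (hp : 1 / 6 < p) (hq : 1 / 3 < q) (hD : 0 ≤ D) (hA : 0 ≤ A) (hS : 0 ≤ S) {δ δu σ : ℝ → ℝ}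
    (hδ : ∀ᶠ β : ℝ in atTop, 0 ≤ δ β ∧ δ β ≤ D * powScale s β) (hδu : ∀ᶠ β : ℝ in atTop, 0 ≤ δu β ∧ δu β ≤ A * powScale p β)
    (hσ : ∀ᶠ β : ℝ in atTop, 0 ≤ σ β ∧ σ β ≤ S * powScale q β) :
    ∀ a : ℝ, 0 < a → ∀ᶠ β : ℝ in atTop,
      (coreEta L β (δ β) (δ β + δu β) (9 * (L : ℝ) * (5 * (powScale (1 / 2) β * btLog β ^ 2)) + powScale 1 β) (min (1 / 40) (powScale (1 / 2) β * btLog β))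
            (powScale 1 β * Fintype.card (Site 3 L)) (σ β) +
          coreEps1 L β (δ β) (9 * (L : ℝ) * (5 * (powScale (1 / 2) β * btLog β ^ 2)) + powScale 1 β) (min (1 / 40) (powScale (1 / 2) β * btLog β)) +
          coreEps2 L β (δ β) (9 * (L : ℝ) * (5 * (powScale (1 / 2) β * btLog β ^ 2)) + powScale 1 β) (min (1 / 40) (powScale (1 / 2) β * btLog β)) (σ β)) ^ 2 ≤
        a * bareLambda ((L : ℝ) ^ 3 * β) := by
  intro a ha
  set m : ℝ := min (min s p) (min (q / 2) (1 / 2)) with hm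
  have hm6 : 1 / 6 < m := by simp only [hm, lt_min_iff]; exact ⟨⟨hs, hp⟩, by linarith only [hq], by norm_num⟩
  have hm0 : 0 < m := by linarith only [hm6]
  have hms : m ≤ s := (min_le_left _ _).trans (min_le_left _ _)
  have hmp : m ≤ p := (min_le_left _ _).trans (min_le_right _ _)
  have hmq : m ≤ q / 2 := (min_le_right _ _).trans (min_le_left _ _)
  have hmh : m ≤ 1 / 2 := (min_le_right _ _).trans (min_le_right _ _)
  have hL1 : (1 : ℝ) ≤ (L : ℝ) := by exact_mod_cast Nat.one_le_iff_ne_zero.mpr (NeZero.ne L)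
  have hC0 : 0 < D + A + S + 45 * (L : ℝ) + 2 := by linarith only [hD, hA, hS, hL1]
  have hK0 : 0 ≤ 1614 * (Fintype.card (Edge 3 L) : ℝ) * (45 * (L : ℝ) + 1) ^ 2 + 216 * (Fintype.card (Site 3 L) : ℝ) +
      145005300 * (Fintype.card (Plaquette 3 L × Fin 3) : ℝ) + 2193291 * (Fintype.card (Plaquette 3 L) : ℝ) * (45 * (L : ℝ) + 1) ^ 2 := by positivity
  obtain ⟨β0, hb⟩ := R50T.polylog_window_affordable (L := L) (s := m)
    (A := (D + A + S + 45 * (L : ℝ) + 2) *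
      (1614 * (Fintype.card (Edge 3 L) : ℝ) * (45 * (L : ℝ) + 1) ^ 2 + 216 * (Fintype.card (Site 3 L) : ℝ) +
        145005300 * (Fintype.card (Plaquette 3 L × Fin 3) : ℝ) + 2193291 * (Fintype.card (Plaquette 3 L) : ℝ) * (45 * (L : ℝ) + 1) ^ 2))
    (ε := 16 * a) (θ := 1) 6 hm6 (mul_nonneg hC0.le hK0) (by linarith only [ha]) one_pos
  have hρ1 : ∀ᶠ β : ℝ in atTop, powScale m β * btLog β ^ 2 ≤ 1 / (D + A + S + 45 * (L : ℝ) + 2) :=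
    (tendsto_powScale_mul_btLog_pow hm0 2).eventually (eventually_le_nhds (by positivity))
  filter_upwards [hδ, hδu, hσ, hρ1, eventually_ge_atTop β0, eventually_ge_atTop (1 : ℝ), eventually_btLog_eq] with β hδβ hδuβ hσβ hρβ hβ0 hβ1 hℓeq
  obtain ⟨hδ0, hδD⟩ := hδβ
  obtain ⟨hδu0, hδuA⟩ := hδuβ
  obtain ⟨hσ0, hσS⟩ := hσβ
  have hβ : (0 : ℝ) ≤ β := by linarith only [hβ1]
  have hCu : (D + A + S + 45 * (L : ℝ) + 2) * (btLog β ^ 2 * powScale m β) ≤ 1 := by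
    have := mul_le_mul_of_nonneg_left hρβ hC0.le
    rwa [mul_one_div_cancel hC0.ne', mul_comm (powScale m β)] at this
  have hδD' : δ β ≤ D * powScale m β := hδD.trans (mul_le_mul_of_nonneg_left (powScale_le_powScale hms β) hD)
  have hδuA' : δu β ≤ A * powScale m β := hδuA.trans (mul_le_mul_of_nonneg_left (powScale_le_powScale hmp β) hA)
  have hσS' : σ β ≤ S * powScale m β ^ 2 := by
    have hq2 : powScale q β = powScale (q / 2) β ^ 2 := by rw [R21.powScale_sq]; congr 1; ring
    have h1 : powScale (q / 2) β ^ 2 ≤ powScale m β ^ 2 := pow_le_pow_left₀ (powScale_pos _ _).le (powScale_le_powScale hmq β) 2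
    calc σ β ≤ S * powScale (q / 2) β ^ 2 := by rw [← hq2]; exact hσS
      _ ≤ S * powScale m β ^ 2 := mul_le_mul_of_nonneg_left h1 hS
  have hηle := windows_exponent_le (L := L) hmh hD hA hS hβ1 hCu hδ0 hδD' hδu0 hδuA' hσS'
  have hT0 := R52.schedT_nonneg (L := L) β
  have hΓ0 : 0 ≤ powScale 1 β * Fintype.card (Site 3 L) := by have := powScale_pos 1 β; positivity
  have hη0 : 0 ≤ coreEta L β (δ β) (δ β + δu β) (9 * (L : ℝ) * (5 * (powScale (1 / 2) β * btLog β ^ 2)) + powScale 1 β)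
        (min (1 / 40) (powScale (1 / 2) β * btLog β)) (powScale 1 β * Fintype.card (Site 3 L)) (σ β) +
      coreEps1 L β (δ β) (9 * (L : ℝ) * (5 * (powScale (1 / 2) β * btLog β ^ 2)) + powScale 1 β) (min (1 / 40) (powScale (1 / 2) β * btLog β)) +
      coreEps2 L β (δ β) (9 * (L : ℝ) * (5 * (powScale (1 / 2) β * btLog β ^ 2)) + powScale 1 β) (min (1 / 40) (powScale (1 / 2) β * btLog β)) (σ β) :=
    add_nonneg (add_nonneg (coreEta_nonneg hβ hδ0 (add_nonneg hδ0 hδu0) hT0 hΓ0 hσ0) (coreEps1_nonneg hβ hδ0 hT0)) (coreEps2_nonneg hβ hT0 hσ0)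
  obtain ⟨b, hb1, hb2⟩ := hb β hβ0
  have hηb := hηle.trans (le_trans (le_of_eq (by rw [hℓeq])) hb1)
  calc _ ≤ b ^ 2 := pow_le_pow_left₀ hη0 hηb 2
    _ ≤ 16 * a * 1 * bareLambda ((L : ℝ) ^ 3 * β) / 16 := hb2
    _ = a * bareLambda ((L : ℝ) ^ 3 * β) := by ring

/-- ★★ **THE FORCED INPUT RADIUS IS AFFORDABLE**: with the minimal input radius `δu = 13(L³β)^{-1/5}` forced by `hcore` (§2; `(L³β)^{-1/5} ≤ β^{-1/5}`, `1/5 > 1/6`), any output radius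
`δ ≤ D·β^{-s}` (`s > 1/6`) and any action ceiling `σ ≤ S·β^{-q}` (`q > 1/3`), the (C4) exponent on schedule B meets `hb_small`. [cite: Luscher1983, §3] -/
theorem hcore_windows_hb_small {s q D S : ℝ} (hs : 1 / 6 < s) (hq : 1 / 3 < q) (hD : 0 ≤ D) (hS : 0 ≤ S) {δ σ : ℝ → ℝ}
    (hδ : ∀ᶠ β : ℝ in atTop, 0 ≤ δ β ∧ δ β ≤ D * powScale s β) (hσ : ∀ᶠ β : ℝ in atTop, 0 ≤ σ β ∧ σ β ≤ S * powScale q β) :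
    ∀ a : ℝ, 0 < a → ∀ᶠ β : ℝ in atTop,
      (coreEta L β (δ β) (δ β + 13 * (((L : ℝ)) ^ 3 * β) ^ (-(1 / 5 : ℝ))) (9 * (L : ℝ) * (5 * (powScale (1 / 2) β * btLog β ^ 2)) + powScale 1 β)
            (min (1 / 40) (powScale (1 / 2) β * btLog β)) (powScale 1 β * Fintype.card (Site 3 L)) (σ β) +
          coreEps1 L β (δ β) (9 * (L : ℝ) * (5 * (powScale (1 / 2) β * btLog β ^ 2)) + powScale 1 β) (min (1 / 40) (powScale (1 / 2) β * btLog β)) +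
          coreEps2 L β (δ β) (9 * (L : ℝ) * (5 * (powScale (1 / 2) β * btLog β ^ 2)) + powScale 1 β) (min (1 / 40) (powScale (1 / 2) β * btLog β)) (σ β)) ^ 2 ≤
        a * bareLambda ((L : ℝ) ^ 3 * β) := by
  refine windows_hb_small (L := L) (p := 1 / 5) (A := 13) (δu := fun β => 13 * (((L : ℝ)) ^ 3 * β) ^ (-(1 / 5 : ℝ))) hs (by norm_num) hq hD (by norm_num) hS hδ ?_ hσ
  filter_upwards [eventually_ge_atTop (1 : ℝ)] with β hβ
  exact ⟨(coreRadius_pos (L := L) (by linarith)).le, coreRadius_le (L := L) hβ⟩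

/-- ★★ **THE LANDED RECORD's INPUT WINDOW CANNOT HOST `BOBricks.𝒰`**: the quaternion window of radius `powScale (1/3) β` (the slow window of `…BOCentralRecord`, p703178) eventually
misses a configuration of the core `{orbitDist < 13(L³β)^{-1/5}}` — so (C4) on `BOBricks` needs an input radius of exponent `≤ 1/5` (affordable by `hcore_windows_hb_small`),
not the record's `1/3`. [folklore] -/
theorem record_inputWindow_not_core :
    ∀ᶠ β : ℝ in atTop, ∃ u : GaugeConfig 3 1 FemtoTransferGap.SU2,
      orbitDist u < 13 * (((L : ℝ)) ^ 3 * β) ^ (-(1 / 5 : ℝ)) ∧ ∃ k : Fin 3, powScale (1 / 3) β < ‖su2Quat (u (0, k)) - 1‖ := by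
  have hL : (0 : ℝ) < (L : ℝ) ^ 3 := pow_pos (by exact_mod_cast Nat.pos_of_ne_zero (NeZero.ne L)) 3
  have hc0 : 0 < 13 / 4 * ((L : ℝ) ^ 3) ^ (-(1 / 5 : ℝ)) := mul_pos (by norm_num) (Real.rpow_pos_of_pos hL _)
  have h1 : ∀ᶠ β : ℝ in atTop, 13 * (((L : ℝ)) ^ 3 * β) ^ (-(1 / 5 : ℝ)) ≤ 1 := (tendsto_coreRadius (L := L)).eventually (eventually_le_nhds one_pos)
  have h2 : ∀ᶠ β : ℝ in atTop, powScale (2 / 15) β < 13 / 4 * ((L : ℝ) ^ 3) ^ (-(1 / 5 : ℝ)) :=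
    (tendsto_powScale' (by norm_num : (0 : ℝ) < 2 / 15)).eventually (eventually_lt_nhds hc0)
  filter_upwards [h1, h2, eventually_ge_atTop (1 : ℝ)] with β h1' h2' hβ
  have hlt : powScale (1 / 3) β < 13 * (((L : ℝ)) ^ 3 * β) ^ (-(1 / 5 : ℝ)) / 4 := by
    have e : powScale (1 / 3) β = powScale (2 / 15) β * powScale (1 / 5) β := by rw [powScale_mul_powScale]; norm_num
    rw [e, coreRadius_eq hβ]
    have h5 : 0 < powScale (1 / 5) β := powScale_pos _ _
    nlinarith
  by_contra H
  push Not at H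
  have := window_radius_of_core (coreRadius_pos (L := L) (by linarith)) h1' (fun u hu k => H u hu k)
  linarith

/-! ## §1c The (C4) windows ANNOUNCED by lane A (`…BOCentralRatesSix`, 2026-08-29: "`δ = δu = σ = β^{-1/3}`") — priced against the box

`…BOCentralRatesSix.tendsto_coreExp_schedule_delta` shows that with `δ = δu = σ = powScale (1/3) β` on schedule B the exponent tends to `0` (TRUE: it is `O_L(ℓ⁸β^{-1/6})`).
Tending to `0` is not the currency of `BOBricks.hb_small`: the SAME function fails `∀ a > 0, ∀ᶠ β, η² ≤ a·λ_b(L³β)` (`σ`-slot `q = 1/3`, R53S), and its input window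
`δu = powScale (1/3) β` cannot host `BOBricks.𝒰` (`record_inputWindow_not_core`).  Repair (theirs): `σ = powScale q β`, `q > 1/3`; `δu = 13(L³β)^{-1/5}` — then
`hcore_windows_hb_small` (with `s = 1/3`, `D = 1`) applies. -/

/-- ★★ **THE ANNOUNCED (C4) WINDOWS `δ = δu = σ = β^{-1/3}` FAIL `hb_small`.**  The exponent of `…BOCentralRatesSix.tendsto_coreExp_schedule_delta` — verbatim the same
function of `β` — is not `o(λ_b(L³β)^{1/2})`: `¬ ∀ a > 0, ∀ᶠ β, η(β)² ≤ a·λ_b(L³β)` (R53S `not_hb_small_of_scaled_exponent` with `c = 1`). [cite: Luscher1983, §3] -/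
theorem announcedWindows_exponent_not_hb_small :
    ¬ ∀ a : ℝ, 0 < a → ∀ᶠ β : ℝ in atTop,
      (coreEta L β (powScale (1 / 3) β) ((powScale (1 / 3) β) + (powScale (1 / 3) β)) (9 * (L : ℝ) * (5 * (powScale (1 / 2) β * btLog β ^ 2)) + powScale 1 β)
            (min (1 / 40) (powScale (1 / 2) β * btLog β)) (powScale 1 β * Fintype.card (Site 3 L)) (powScale (1 / 3) β) +
          coreEps1 L β (powScale (1 / 3) β) (9 * (L : ℝ) * (5 * (powScale (1 / 2) β * btLog β ^ 2)) + powScale 1 β) (min (1 / 40) (powScale (1 / 2) β * btLog β)) +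
          coreEps2 L β (powScale (1 / 3) β) (9 * (L : ℝ) * (5 * (powScale (1 / 2) β * btLog β ^ 2)) + powScale 1 β) (min (1 / 40) (powScale (1 / 2) β * btLog β))
            (powScale (1 / 3) β)) ^ 2 ≤
        a * bareLambda ((L : ℝ) ^ 3 * β) :=
  R53S.not_hb_small_of_scaled_exponent (L := L) (δ := fun β => powScale (1 / 3) β) (δu := fun β => powScale (1 / 3) β)
    (R := fun β => min (1 / 40) (powScale (1 / 2) β * btLog β)) (Γ := fun β => powScale 1 β * Fintype.card (Site 3 L)) (c := 1) one_pos
    (fun β => (powScale_pos _ β).le) (fun β => (powScale_pos _ β).le) (fun β => mul_nonneg (powScale_pos _ β).le (Nat.cast_nonneg _))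
    (Eventually.of_forall fun β => by rw [one_mul])

/-- ★ **… AND THE REPAIRED WINDOWS PASS**: keep the output radius `δ ≤ powScale (1/3) β` (`s = 1/3 > 1/6`), take the input radius forced by `hcore`, `δu = 13(L³β)^{-1/5}`, and any action
ceiling `0 ≤ σ ≤ S·powScale q β` with `q > 1/3`; then the exponent meets `hb_small` (`hcore_windows_hb_small`, `D = 1`). [folklore] -/
theorem repairedWindows_exponent_hb_small {q S : ℝ} (hq : 1 / 3 < q) (hS : 0 ≤ S) {σ : ℝ → ℝ} (hσ : ∀ᶠ β : ℝ in atTop, 0 ≤ σ β ∧ σ β ≤ S * powScale q β) :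
    ∀ a : ℝ, 0 < a → ∀ᶠ β : ℝ in atTop,
      (coreEta L β (powScale (1 / 3) β) (powScale (1 / 3) β + 13 * (((L : ℝ)) ^ 3 * β) ^ (-(1 / 5 : ℝ))) (9 * (L : ℝ) * (5 * (powScale (1 / 2) β * btLog β ^ 2)) + powScale 1 β)
            (min (1 / 40) (powScale (1 / 2) β * btLog β)) (powScale 1 β * Fintype.card (Site 3 L)) (σ β) +
          coreEps1 L β (powScale (1 / 3) β) (9 * (L : ℝ) * (5 * (powScale (1 / 2) β * btLog β ^ 2)) + powScale 1 β) (min (1 / 40) (powScale (1 / 2) β * btLog β)) +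
          coreEps2 L β (powScale (1 / 3) β) (9 * (L : ℝ) * (5 * (powScale (1 / 2) β * btLog β ^ 2)) + powScale 1 β) (min (1 / 40) (powScale (1 / 2) β * btLog β)) (σ β)) ^ 2 ≤
        a * bareLambda ((L : ℝ) ^ 3 * β) :=
  hcore_windows_hb_small (L := L) (s := 1 / 3) (D := 1) (by norm_num) hq zero_le_one hS (δ := fun β => powScale (1 / 3) β)
    (Eventually.of_forall fun β => ⟨(powScale_pos _ β).le, by rw [one_mul]⟩) hσ

/-! ## §2 From the exponent to the defect constant `ε = max (1 − e^{−η}(1 − η_c)) (e^{η}(1 + η_c) − 1)` -/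

/-- `ε ≤ 3(η + η_c)` for `0 ≤ η ≤ 1`, `0 ≤ η_c ≤ 1` (`e^{η} ≤ 1 + η + η²`, `e^{−η} ≥ 1 − η`). [folklore] -/
theorem defectConst_le_three {η ηc : ℝ} (hη0 : 0 ≤ η) (hη1 : η ≤ 1) (hc0 : 0 ≤ ηc) (hc1 : ηc ≤ 1) :
    max (1 - Real.exp (-η) * (1 - ηc)) (Real.exp η * (1 + ηc) - 1) ≤ 3 * (η + ηc) := by
  refine max_le ?_ ?_
  · have h1 : 1 - η ≤ Real.exp (-η) := by have := Real.add_one_le_exp (-η); linarith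
    nlinarith [mul_le_mul_of_nonneg_right h1 (by linarith : 0 ≤ 1 - ηc), Real.exp_pos (-η)]
  · have h := Real.abs_exp_sub_one_sub_id_le (by rw [abs_of_nonneg hη0]; exact hη1)
    have h2 : Real.exp η ≤ 1 + 2 * η := by have := (abs_le.mp h).2; nlinarith
    nlinarith [mul_le_mul_of_nonneg_right h2 (by linarith : 0 ≤ 1 + ηc)]

omit [NeZero L] in
/-- ★ **`hb_small` passes from the two exponents to the defect constant**: if `η(β)², η_c(β)² ≤ a·λ_b(L³β)` eventually for every `a > 0` and `0 ≤ η, η_c ≤ 1` eventually, then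
`ε(β)² ≤ a·λ_b(L³β)` eventually for every `a > 0` (`ε ≤ 3(η + η_c)`, `ε² ≤ 18(η² + η_c²)`). [folklore] -/
theorem defectConst_hb_small {η ηc : ℝ → ℝ} (hη : ∀ᶠ β : ℝ in atTop, 0 ≤ η β ∧ η β ≤ 1) (hηc : ∀ᶠ β : ℝ in atTop, 0 ≤ ηc β ∧ ηc β ≤ 1)
    (h1 : ∀ a : ℝ, 0 < a → ∀ᶠ β : ℝ in atTop, η β ^ 2 ≤ a * bareLambda ((L : ℝ) ^ 3 * β))
    (h2 : ∀ a : ℝ, 0 < a → ∀ᶠ β : ℝ in atTop, ηc β ^ 2 ≤ a * bareLambda ((L : ℝ) ^ 3 * β)) :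
    ∀ a : ℝ, 0 < a → ∀ᶠ β : ℝ in atTop,
      (max (1 - Real.exp (-η β) * (1 - ηc β)) (Real.exp (η β) * (1 + ηc β) - 1)) ^ 2 ≤ a * bareLambda ((L : ℝ) ^ 3 * β) := by
  intro a ha
  filter_upwards [hη, hηc, h1 (a / 36) (by positivity), h2 (a / 36) (by positivity)] with β hηβ hηcβ hb1 hb2
  obtain ⟨hη0, hη1⟩ := hηβ
  obtain ⟨hc0, hc1⟩ := hηcβ
  have hle := defectConst_le_three hη0 hη1 hc0 hc1
  have hε0 : 0 ≤ max (1 - Real.exp (-η β) * (1 - ηc β)) (Real.exp (η β) * (1 + ηc β) - 1) :=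
    le_trans hc0 (R53S.etac_le_defectConst hη0 hc0)
  calc _ ≤ (3 * (η β + ηc β)) ^ 2 := pow_le_pow_left₀ hε0 hle 2
    _ ≤ 18 * (η β ^ 2 + ηc β ^ 2) := by nlinarith [sq_nonneg (η β - ηc β)]
    _ ≤ 18 * (a / 36 * bareLambda ((L : ℝ) ^ 3 * β) + a / 36 * bareLambda ((L : ℝ) ^ 3 * β)) := by nlinarith
    _ = a * bareLambda ((L : ℝ) ^ 3 * β) := by ring

/-- Exponents and constants: the `hcore` radius has exponent `1/5 ∈ (1/6, 1/3)`; `558 + 192 + 288 + 576 = 1614`, `50 + 5040 + 160 + 145000000 + 50 = 145005300`,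
`2·1728 + 3·29376 + 3·700569 = 2193291`; `ps(1/3) = ps(2/15)·ps(1/5)`. [folklore] -/
example : (1 : ℝ) / 6 < 1 / 5 ∧ (1 : ℝ) / 5 < 1 / 3 ∧ (558 : ℝ) + 192 + 288 + 576 = 1614 ∧ (50 : ℝ) + 5040 + 160 + 145000000 + 50 = 145005300 ∧
    (2 : ℝ) * 1728 + 3 * 29376 + 3 * 700569 = 2193291 ∧ (2 : ℝ) / 15 + 1 / 5 = 1 / 3 := by norm_num

end Summit.QuantumFields.YangMills.Theorems.TwistedTraceScaling.Negative.R54B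

end
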